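import Summits.CriticalPhenomena.CardyFormulaZ2.Theorems.CardyComplexConeEdgePrecompactPassageAgree
import Summits.CriticalPhenomena.CardyFormulaZ2.Theorems.CardyComplexConeEdgePrecompactTranslationCovariance

/-!
# Response stability from forward response stability
(line `qkz-strip-boundary-arm` of crux `CardyComplexCone.EdgePrecompact`, stmt-CriticalPhenomena-11387)

The registered stub `stub_responseStability` (the residual probabilistic input of shift-coupling
locality, see `hullStability_of_responseStability` in
`Theorems/CardyComplexConeEdgePrecompactHullStabilityReduction.lean`) asks that, along a discretisation
family `Λ` of a Jordan Dobrushin domain `D`, uniformly over corners `δv ∈ K` and lattice shifts `w` with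
`‖δw‖ < η`, the dynamics of the datum `E₀ = Λ δ` and of its translate `E₁ = shiftData (Λ δ) w`, run in
ONE configuration `ω`, respond alike at the ball `B(δv, ρ)` IN BOTH DIRECTIONS: every stretch of the
`E₀`-orbit (from the start corner, or from an exit corner of the ball) which re-enters the ball through
inner faces is matched by the corresponding `E₁`-stretch (same re-entry corner, through inner faces, same
accumulated turning) — the FORWARD response — and symmetrically with the roles of `E₀`, `E₁` exchanged —
the BACKWARD response.

This file halves the statement: RESPONSE STABILITY follows from FORWARD RESPONSE STABILITY (the same
statement with the backward clause deleted), registered sub-goal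
`responseStability_of_forwardResponseStability`. The backward response of the pair `(Λ δ, w)` at the
ball centred at `δv` in the configuration `ω` is, read through the lattice translation `x ↦ x - w`,
literally the forward response of the pair `(Λ δ, -w)` at the ball centred at `δ(v - w)` in the
translated configuration `ω - w`: the completed configurations, inner faces, start corners, orbits of
Smirnov's successor map and their turns are transported by the translation
(`bcBondConfig_shiftData`, `isInnerFace_shiftData_iff` of `…MedialExplorationShiftData.lean`, and
`cornerOrbit_relabel_shift`, `turnOf_relabel_shift`, `isStartCorner_shiftData_iff` below), and
`shiftData (shiftData E (-w)) w = E`. Since `P_{1/2}` is translation invariant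
(`bondPercolation_real_preimage_shift`) and `δ(v - w)` stays in a slightly larger compact
`cthickening t K` (with `cthickening (2ρ) (cthickening t K) ⊆ D`, `t > 0` by compactness), a union bound
with `ε/2 + ε/2` concludes. No admissibility and no smallness of the mesh is used: the reduction is pure
transport of structure.

Why only this much is reduced here. The forward statement is the genuine RSW/arm content (planner's
step (c) of the sibling card `shift-coupling-phase-exact`): a differing response forces a collar box of
`∂D` (where the two data differ) to be pivotal for the loop structure at distance `≥ ρ` — a boundary
three-arm event from scale `η` to scale `ρ`, to be summed over the collar — or a re-rooting at a marked
point (boundary two-arm event); see the notes left with the lead. The deterministic halving proved here is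
exact (the two directions are the same statement up to the symmetry `w ↦ -w` of the hypotheses), so no
strength is lost.

References: S. Smirnov, C. R. Acad. Sci. Paris 333 (2001), §2 (the exploration process);
G. Grimmett, *Percolation*, 2nd ed. (1999), §1.6 (translation invariance of `P_p`), §11.2.
-/

namespace Summit.CriticalPhenomena.CardyFormulaZ2.Cruxes.EdgePrecompact.QkzStripBoundaryArm

open MeasureTheory Filter Set Metric
open scoped Topology BigOperators Pointwise
open Literature.Probability.LatticeModels Literature.Probability.Percolation
open Literature.Probability.RandomPlanarGeometry (DobrushinDomain)
open Summit.CriticalPhenomena.CardyFormulaZ2.Theses.CardyComplexCone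

noncomputable section

/-! ## Coded corners, the successor map and its orbits under a lattice translation -/

section Transport

variable (w : Site 2)

/-- Translated coded corners are equal iff the corners are. -/
theorem shiftCorner_inj (p q : Site 2 × Fin 4) : ((p.1 + w, p.2) = (q.1 + w, q.2)) ↔ p = q := by
  simp only [Prod.ext_iff, add_left_inj]

/-- The source edge of a translated coded corner is the translated source edge. -/
theorem cSrc_shift (c : Site 2 × Fin 4) : cSrc (c.1 + w, c.2) = sym2Equiv (Site.shift w) (cSrc c) := by
  rw [cSrc, cSrc, sym2Equiv_mk, Site.shift_apply, Site.shift_apply, add_right_comm]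

/-- The target edge of a translated coded corner is the translated target edge. -/
theorem cTgt_shift (c : Site 2 × Fin 4) : cTgt (c.1 + w, c.2) = sym2Equiv (Site.shift w) (cTgt c) := by
  rw [cTgt, cTgt, sym2Equiv_mk, Site.shift_apply, Site.shift_apply, add_right_comm]

/-- The face of a translated coded corner is the translated face. -/
theorem cFace_shift (c : Site 2 × Fin 4) : cFace (c.1 + w, c.2) = cFace c + w := by
  rw [cFace, cFace, faceAt, faceAt]
  simp only
  abel

/-- The `k`-th face around a translated vertex is the translated face. -/
theorem faceAt_add (x : Site 2) (k : Fin 4) : faceAt (x + w) k = faceAt x k + w := by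
  rw [faceAt, faceAt]; abel

/-- Smirnov's successor map commutes with translating corner and configuration. -/
theorem nextCorner_relabel_shift (β : BondConfig (Site 2)) (c : Site 2 × Fin 4) :
    nextCorner (BondConfig.relabel (sym2Equiv (Site.shift w)) β) (c.1 + w, c.2) =
      ((nextCorner β c).1 + w, (nextCorner β c).2) := by
  by_cases h : cTgt c ∈ β
  · have h' : cTgt (c.1 + w, c.2) ∈ BondConfig.relabel (sym2Equiv (Site.shift w)) β := by
      rw [cTgt_shift, apply_mem_relabel_iff]; exact h
    rw [nextCorner_of_mem h', nextCorner_of_mem h]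
    simp only [add_right_comm _ w]
  · have h' : cTgt (c.1 + w, c.2) ∉ BondConfig.relabel (sym2Equiv (Site.shift w)) β := by
      rw [cTgt_shift, apply_mem_relabel_iff]; exact h
    rw [nextCorner_of_not_mem h', nextCorner_of_not_mem h]

/-- Orbits of the successor map commute with translating corner and configuration. -/
theorem cornerOrbit_relabel_shift (β : BondConfig (Site 2)) (c : Site 2 × Fin 4) (n : ℕ) :
    cornerOrbit (BondConfig.relabel (sym2Equiv (Site.shift w)) β) (c.1 + w, c.2) n =
      ((cornerOrbit β c n).1 + w, (cornerOrbit β c n).2) := by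
  induction n with
  | zero => rfl
  | succ n ih =>
    show nextCorner _ (cornerOrbit _ _ n) =
      ((nextCorner β (cornerOrbit β c n)).1 + w, (nextCorner β (cornerOrbit β c n)).2)
    rw [ih, nextCorner_relabel_shift]

/-- The turn at the end of a corner is translation invariant. -/
theorem turnOf_relabel_shift (β : BondConfig (Site 2)) (c : Site 2 × Fin 4) :
    turnOf (BondConfig.relabel (sym2Equiv (Site.shift w)) β) (c.1 + w, c.2) = turnOf β c := by
  by_cases h : cTgt c ∈ β
  · have h' : cTgt (c.1 + w, c.2) ∈ BondConfig.relabel (sym2Equiv (Site.shift w)) β := by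
      rw [cTgt_shift, apply_mem_relabel_iff]; exact h
    simp only [turnOf]
    rw [if_pos h', if_pos h]
  · have h' : cTgt (c.1 + w, c.2) ∉ BondConfig.relabel (sym2Equiv (Site.shift w)) β := by
      rw [cTgt_shift, apply_mem_relabel_iff]; exact h
    simp only [turnOf]
    rw [if_neg h', if_neg h]

/-- Sourced face-boundary edges of the translated data are the translated ones. -/
theorem isOutEdge_shiftData_iff (E : DiscreteDobrushin) (x : Site 2) (k : Fin 4) :
    (shiftData E w).IsOutEdge (x + w) k ↔ E.IsOutEdge x k := by
  unfold DiscreteDobrushin.IsOutEdge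
  rw [faceAt_add, faceAt_add, isInnerFace_shiftData_iff, isInnerFace_shiftData_iff]

/-- Start corners of the translated data are the translated start corners. -/
theorem isStartCorner_shiftData_iff (E : DiscreteDobrushin) (c : Site 2 × Fin 4) :
    (shiftData E w).IsStartCorner (c.1 + w, c.2) ↔ E.IsStartCorner c := by
  constructor
  · rintro ⟨hA, hB, hO⟩
    refine ⟨(mem_zdArcA_shiftData_iff E w c.1).1 hA, (mem_zdArcB_shiftData_iff E w _).1 ?_,
      (isOutEdge_shiftData_iff w E c.1 c.2).1 hO⟩
    have hB' : c.1 + w + cornerUnit c.2 ∈ (shiftData E w).zdArcB := hB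
    rwa [add_right_comm] at hB'
  · rintro ⟨hA, hB, hO⟩
    refine ⟨(mem_zdArcA_shiftData_iff E w c.1).2 hA, ?_, (isOutEdge_shiftData_iff w E c.1 c.2).2 hO⟩
    show c.1 + w + cornerUnit c.2 ∈ (shiftData E w).zdArcB
    rw [add_right_comm]
    exact (mem_zdArcB_shiftData_iff E w _).2 hB

/-- Inner faces of `E`, read at translated faces, are the inner faces of the data translated back. -/
theorem isInnerFace_add_iff_shiftData_neg (E : DiscreteDobrushin) (f : Site 2) :
    E.IsInnerFace (f + w) ↔ (shiftData E (-w)).IsInnerFace f := by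
  conv_lhs => rw [← shiftData_shiftData_neg E w]
  exact isInnerFace_shiftData_iff _ _ _

/-- Start corners of `E`, read at translated corners, are the start corners of the data translated
back. -/
theorem isStartCorner_add_iff_shiftData_neg (E : DiscreteDobrushin) (c : Site 2 × Fin 4) :
    E.IsStartCorner (c.1 + w, c.2) ↔ (shiftData E (-w)).IsStartCorner c := by
  conv_lhs => rw [← shiftData_shiftData_neg E w]
  exact isStartCorner_shiftData_iff _ _ _

/-- Completing a translated configuration: `E.bc (ω + w) = (shiftData E (-w)).bc ω + w`. -/
theorem bcBondConfig_relabel_shift (E : DiscreteDobrushin) (ω : BondConfig (Site 2)) :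
    E.bcBondConfig (BondConfig.relabel (sym2Equiv (Site.shift w)) ω) =
      BondConfig.relabel (sym2Equiv (Site.shift w)) ((shiftData E (-w)).bcBondConfig ω) := by
  conv_lhs => rw [← shiftData_shiftData_neg E w]
  exact bcBondConfig_shiftData _ _ _

/-- Every configuration is the translate by `w` of its translate by `-w`. -/
theorem eq_relabel_shift_relabel_neg (ω : BondConfig (Site 2)) :
    ω = BondConfig.relabel (sym2Equiv (Site.shift w)) (BondConfig.relabel (sym2Equiv (Site.shift (-w))) ω) := by
  rw [sym2Equiv_shift_neg]
  exact (relabel_symm_relabel_eq (sym2Equiv (Site.shift w)).symm ω).symm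

/-- Mesh points are subtractive: `δ(v - w) = δv - δw`. -/
theorem meshPoint_sub_shift (δ : ℝ) (v : Site 2) : meshPoint δ (v - w) = meshPoint δ v - meshPoint δ w :=
  eq_sub_of_add_eq (by rw [add_comm, ← meshPoint_add_shift, sub_add_cancel])

/-- A translated medial vertex lies in the ball iff the vertex lies in the ball translated back. -/
theorem medialPoint_shift_mem_ball_iff (δ : ℝ) (v : Site 2) (ρ : ℝ) (e : MedialVertex) :
    medialPoint δ (sym2Equiv (Site.shift w) e) ∈ ball (meshPoint δ v) ρ ↔
      medialPoint δ e ∈ ball (meshPoint δ (v - w)) ρ := by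
  rw [medialPoint_shift, mem_ball, mem_ball, meshPoint_sub_shift, dist_eq_norm, dist_eq_norm]
  congr! 2
  abel

end Transport

/-! ## The reduction -/

/-- **Response stability from forward response stability** (registered sub-goal
`responseStability_of_forwardResponseStability` of stmt-CriticalPhenomena-11387). HYPOTHESIS (FORWARD
RESPONSE STABILITY, inline): the registered statement `stub_responseStability` with its backward clause
deleted — along a discretisation family `Λ` of `D`, on a compact `K` with `cthickening (2ρ) K ⊆ D`, for
every `ε > 0` there is `η > 0` such that eventually in `δ`, for every corner `(v,f)` with `δv ∈ K` and
every `w` with `‖δw‖ < η`, with `P_{1/2}`-probability `≥ 1 - ε`, for every admissible pair of corners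
`(a, a')` (the two start corners, or a common exit corner of the ball `B(δv, ρ)`), every stretch of the
`Λ δ`-orbit of `a` re-entering the ball through inner faces is matched by a stretch of the
`shiftData (Λ δ) w`-orbit of `a'` (same corner, inner faces, same turning sum). CONCLUSION: the
statement of `stub_responseStability`, verbatim (both directions). Proof: the backward clause at
`(v, w, ω)` is the forward clause at `(v - w, -w, ω - w)`; translation invariance of `P_{1/2}` and a
union bound. -/
theorem responseStability_of_forwardResponseStability : (∀ (D : DobrushinDomain) (Λ : ℝ → DiscreteDobrushin), (∀ δ, (Λ δ).Ω = D.carrier) → (∀ δ, (Λ δ).δ = δ) → (∀ᶠ δ in nhdsWithin (0:ℝ) (Set.Ioi 0), (Λ δ).IsZdAdmissible) → ∀ K : Set ℂ, IsCompact K → K ⊆ D.carrier → ∀ ρ > (0:ℝ), cthickening (2 * ρ) K ⊆ D.carrier → ∀ ε > (0:ℝ), ∃ η > (0:ℝ), ∀ᶠ δ in nhdsWithin (0:ℝ) (Set.Ioi 0), ∀ v f w : Site 2, IsCorner v f → meshPoint δ v ∈ K → ‖meshPoint δ w‖ < η → (bondPercolation (zdGraph 2) half).real {ω : BondConfig (Site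 2) | ¬ ∀ a a' : Site 2 × Fin 4, (((Λ δ).IsStartCorner a ∧ (shiftData (Λ δ) w).IsStartCorner a') ∨ (a = a' ∧ medialPoint δ (cSrc a) ∈ ball (meshPoint δ v) ρ ∧ medialPoint δ (cTgt a) ∉ ball (meshPoint δ v) ρ)) → ∀ n : ℕ, (∀ i < n, medialPoint δ (cTgt (cornerOrbit ((Λ δ).bcBondConfig ω) a i)) ∉ ball (meshPoint δ v) ρ ∧ (Λ δ).IsInnerFace (cFace (cornerOrbit ((Λ δ).bcBondConfig ω) a (i + 1)))) → medialPoint δ (cTgt (cornerOrbit ((Λ δ).bcBondConfig ω) a n)) ∈ ball (meshPoint δ v) ρ → ∃ n' : ℕ, (∀ i < n', medialPoint δ (cTgt (cornerOrbit ((shiftData (Λ δ) w).bcBondConfig ω) a' i)) ∉ ball (meshPoint δ v) ρ ∧ (shiftData (Λ δ) w).IsInnerFace (cFace (cornerOrbit ((shiftData (Λ δ) w).bcBondConfig ω) a' (i + 1)))) ∧ cornerOrbit ((shiftData (Λ δ) w).bcBondConfig ω) a' n' = cornerOrbit ((Λ δ).bcBondConfig ω) a n ∧ ∑ i ∈ Finset.range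 n', turnOf ((shiftData (Λ δ) w).bcBondConfig ω) (cornerOrbit ((shiftData (Λ δ) w).bcBondConfig ω) a' i) = ∑ i ∈ Finset.range n, turnOf ((Λ δ).bcBondConfig ω) (cornerOrbit ((Λ δ).bcBondConfig ω) a i)} ≤ ε) → ∀ (D : DobrushinDomain) (Λ : ℝ → DiscreteDobrushin), (∀ δ, (Λ δ).Ω = D.carrier) → (∀ δ, (Λ δ).δ = δ) → (∀ᶠ δ in nhdsWithin (0:ℝ) (Set.Ioi 0), (Λ δ).IsZdAdmissible) → ∀ K : Set ℂ, IsCompact K → K ⊆ D.carrier → ∀ ρ > (0:ℝ), cthickening (2 * ρ) K ⊆ D.carrier → ∀ ε > (0:ℝ), ∃ η > (0:ℝ), ∀ᶠ δ in nhdsWithin (0:ℝ) (Set.Ioi 0), ∀ v f w : Site 2, IsCorner v f → meshPoint δ v ∈ K → ‖meshPoint δ w‖ < η → (bondPercolation (zdGraph 2) half).real {ω : BondConfig (Site 2) | ¬ ∀ a a' : Site 2 × Fin 4, (((Λ δ).IsStartCorner a ∧ (shiftData (Λ δ) w).IsStartCorner a') ∨ (a = a' ∧ medialPoint δ (cSrc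 a) ∈ ball (meshPoint δ v) ρ ∧ medialPoint δ (cTgt a) ∉ ball (meshPoint δ v) ρ)) → (∀ n : ℕ, (∀ i < n, medialPoint δ (cTgt (cornerOrbit ((Λ δ).bcBondConfig ω) a i)) ∉ ball (meshPoint δ v) ρ ∧ (Λ δ).IsInnerFace (cFace (cornerOrbit ((Λ δ).bcBondConfig ω) a (i + 1)))) → medialPoint δ (cTgt (cornerOrbit ((Λ δ).bcBondConfig ω) a n)) ∈ ball (meshPoint δ v) ρ → ∃ n' : ℕ, (∀ i < n', medialPoint δ (cTgt (cornerOrbit ((shiftData (Λ δ) w).bcBondConfig ω) a' i)) ∉ ball (meshPoint δ v) ρ ∧ (shiftData (Λ δ) w).IsInnerFace (cFace (cornerOrbit ((shiftData (Λ δ) w).bcBondConfig ω) a' (i + 1)))) ∧ cornerOrbit ((shiftData (Λ δ) w).bcBondConfig ω) a' n' = cornerOrbit ((Λ δ).bcBondConfig ω) a n ∧ ∑ i ∈ Finset.range n', turnOf ((shiftData (Λ δ) w).bcBondConfig ω) (cornerOrbit ((shiftData (Λ δ) w).bcBondConfig ω) a' i) = ∑ i ∈ Finset.range n, turnOf ((Λ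 δ).bcBondConfig ω) (cornerOrbit ((Λ δ).bcBondConfig ω) a i)) ∧ (∀ n : ℕ, (∀ i < n, medialPoint δ (cTgt (cornerOrbit ((shiftData (Λ δ) w).bcBondConfig ω) a' i)) ∉ ball (meshPoint δ v) ρ ∧ (shiftData (Λ δ) w).IsInnerFace (cFace (cornerOrbit ((shiftData (Λ δ) w).bcBondConfig ω) a' (i + 1)))) → medialPoint δ (cTgt (cornerOrbit ((shiftData (Λ δ) w).bcBondConfig ω) a' n)) ∈ ball (meshPoint δ v) ρ → ∃ n' : ℕ, (∀ i < n', medialPoint δ (cTgt (cornerOrbit ((Λ δ).bcBondConfig ω) a i)) ∉ ball (meshPoint δ v) ρ ∧ (Λ δ).IsInnerFace (cFace (cornerOrbit ((Λ δ).bcBondConfig ω) a (i + 1)))) ∧ cornerOrbit ((Λ δ).bcBondConfig ω) a n' = cornerOrbit ((shiftData (Λ δ) w).bcBondConfig ω) a' n ∧ ∑ i ∈ Finset.range n', turnOf ((Λ δ).bcBondConfig ω) (cornerOrbit ((Λ δ).bcBondConfig ω) a i) = ∑ i ∈ Finset.range n, turnOf ((shiftData (Λ δ) w).bcBondConfig ω)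 (cornerOrbit ((shiftData (Λ δ) w).bcBondConfig ω) a' i))} ≤ ε := by
  intro hF D Λ hΩ hδ hadm K hK hKD ρ hρ hρK ε hε
  -- a margin `t > 0` with `cthickening (2ρ) (cthickening t K) ⊆ D`
  obtain ⟨t, ht, htD⟩ := (hK.cthickening (r := 2 * ρ)).exists_cthickening_subset_open D.isOpen hρK
  have hK' : IsCompact (cthickening t K) := hK.cthickening
  have hKK' : K ⊆ cthickening t K := self_subset_cthickening K
  have hK'D : cthickening t K ⊆ D.carrier :=
    ((cthickening_subset_of_subset t (self_subset_cthickening K)).trans htD)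
  have hρK' : cthickening (2 * ρ) (cthickening t K) ⊆ D.carrier := by
    rw [cthickening_cthickening (by positivity) ht.le, add_comm, ← cthickening_cthickening ht.le (by positivity)]
    exact htD
  obtain ⟨η₀, hη₀, hev⟩ := hF D Λ hΩ hδ hadm (cthickening t K) hK' hK'D ρ hρ hρK' (ε / 2) (half_pos hε)
  refine ⟨min η₀ t, lt_min hη₀ ht, ?_⟩
  filter_upwards [hev] with δ hevδ
  intro v f w hvf hvK hw
  have hwη : ‖meshPoint δ w‖ < η₀ := lt_of_lt_of_le hw (min_le_left _ _)
  have hwt : ‖meshPoint δ w‖ < t := lt_of_lt_of_le hw (min_le_right _ _)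
  have hvK' : meshPoint δ v ∈ cthickening t K := hKK' hvK
  have hv'K' : meshPoint δ (v - w) ∈ cthickening t K := by
    refine mem_cthickening_of_dist_le _ _ _ K hvK ?_
    rw [meshPoint_sub_shift, dist_eq_norm, sub_sub_cancel_left, norm_neg]
    exact hwt.le
  have hvf' : IsCorner (v - w) (f - w) := by
    rw [← isCorner_add_iff (v - w) (f - w) w, sub_add_cancel, sub_add_cancel]; exact hvf
  have hw' : ‖meshPoint δ (-w)‖ < η₀ := by rwa [meshPoint_neg, norm_neg]
  -- the forward bound at `(v, w)` and at `(v - w, -w)`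
  have h₁ := hevδ v f w hvf hvK' hwη
  have h₂ := hevδ (v - w) (f - w) (-w) hvf' hv'K' hw'
  refine le_trans (measureReal_mono ?_) ((measureReal_union_le _ _).trans
    ((add_le_add h₁ ((bondPercolation_real_preimage_shift (-w) half _).le.trans h₂)).trans_eq
      (add_halves ε)))
  -- the event "responses differ" is contained in "forward responses differ" ∪ ("… at (v-w,-w)") - w
  intro ω hω
  by_contra hc
  simp only [Set.mem_union, Set.mem_setOf_eq, Set.mem_preimage, not_or, not_not] at hc
  obtain ⟨hc₁, hc₂⟩ := hc
  apply hω
  intro a a' hpair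
  refine ⟨hc₁ a a' hpair, ?_⟩
  -- the backward clause, read through the translation by `-w`
  generalize hω' : BondConfig.relabel (sym2Equiv (Site.shift (-w))) ω = ω' at hc₂
  have hωeq : ω = BondConfig.relabel (sym2Equiv (Site.shift w)) ω' := by
    rw [← hω']; exact eq_relabel_shift_relabel_neg w ω
  subst hωeq
  obtain ⟨b, rfl⟩ : ∃ b : Site 2 × Fin 4, a' = (b.1 + w, b.2) := ⟨(a'.1 - w, a'.2), by simp⟩
  obtain ⟨b', rfl⟩ : ∃ b' : Site 2 × Fin 4, a = (b'.1 + w, b'.2) := ⟨(a.1 - w, a.2), by simp⟩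
  rw [bcBondConfig_shiftData, bcBondConfig_relabel_shift]
  simp only [cornerOrbit_relabel_shift, cTgt_shift, cFace_shift, turnOf_relabel_shift, shiftCorner_inj,
    medialPoint_shift_mem_ball_iff, isInnerFace_shiftData_iff]
  simp only [isInnerFace_add_iff_shiftData_neg]
  refine hc₂ b b' ?_
  rcases hpair with ⟨h0, h1⟩ | ⟨heq, hs, ht'⟩
  · rw [isStartCorner_shiftData_iff] at h1
    rw [isStartCorner_add_iff_shiftData_neg] at h0
    exact Or.inl ⟨h1, h0⟩
  · rw [shiftCorner_inj] at heq
    subst heq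
    rw [cSrc_shift, medialPoint_shift_mem_ball_iff] at hs
    rw [cTgt_shift, medialPoint_shift_mem_ball_iff] at ht'
    exact Or.inr ⟨rfl, hs, ht'⟩

end

end Summit.CriticalPhenomena.CardyFormulaZ2.Cruxes.EdgePrecompact.QkzStripBoundaryArm
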